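import Summits.QuantumFields.YangMills.Theorems.BalabanUVNodesN19JacksonSmoothingC11
import Summits.QuantumFields.YangMills.Theorems.BalabanUVNodesN19LipschitzLinkTrigSmoothing

/-!
# YM-DAG node N19 (= NE7 proper) — SECOND-ORDER TRIGONOMETRIC SMOOTHING OF A `C²` LINK ON `[0, d]` (JACKSON KERNEL, NO STEKLOV STEP)
# (the `C¹` odd `2d`-periodic extension of `h − affine` as the PRIMITIVE of the even extension of `h′ − λ`; module 151's input with `B₂ = sup|h″|`)

Cell `pub-ymgap`, HUMAN RULING D-0062 (Track A) ∕ D-0149, R141 (C) seat `pub-ymgap-dag-n19-e` (s3 = ALTERNATIVE CURRENCY), generation g35,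
module 3 (lineage module 187).  Route `Summits/QuantumFields/YangMills/Theses/BalabanUVNodes.lean`, cluster item K3⁸ «SpineGivenEndpointR13SepCoPHV»
(stmt-QuantumFields-27366); filed `--supports` that item `--as helper` (it proves no registered stub).  COUNT-NEUTRAL: [folklore]∕[bookkeeping] over
Mathlib (`Continuous.integral_hasStrictDerivAt`, `intervalIntegral.integral_eq_sub_of_hasDerivAt`, `Function.Periodic.intervalIntegral_add_eq`,
`Convex.norm_image_sub_le_of_norm_hasDerivWithin_le`, `AddCircle` norms) and, BY NAME, module 186 `…N19JacksonSmoothingC11`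
(`exists_trigLink_near_periodicC11_jackson`), module 185 (`continuous_of_abs_sub_le`), module 152a `…N19LipschitzLinkTrigSmoothing` (`circleNorm_*`);
no laws, no scheme object, no Theses import; NOT a discharge claim.

CONTENT — module 167 (`exists_trigLink_near_lipschitzLink_jackson`) for `C²` links.  For `h` with `h′`, `h″` everywhere, `|h′| ≤ K` and `|h″| ≤ κ` on
`[0, d]`: subtract the chord `λs`, `λ = (h(d) − h(0))∕d` (`|λ| ≤ K`), and extend `h₀ = h − h(0) − λ·` to a `C¹` `2π`-periodic function of `θ = πs∕d` as
the PRIMITIVE `f(θ) = ∫_0^θ f₁` of the EVEN extension `f₁(θ) = (d∕π)(h′((d∕π)‖θ‖) − λ)` (`‖θ‖` the distance to `2πℤ`): `f₁` is continuous, `2π`-periodic,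
`(d∕π)²κ`-Lipschitz and bounded by `2Kd∕π`, `∫_0^{2π}f₁ = 2(h(d) − h(0) − λd) = 0` makes `f` periodic, `f′ = f₁` by the fundamental theorem, `|f| ≤ 4Kd`,
and `f(πs∕d) = h(s) − h(0) − λs` on `[0, d]` — no case analysis at the reflection points.  Module 186 smooths `f`; rescaling `θ = πs∕d` gives ★★
`exists_trigLink_near_C11Link_jackson`: modes `≤ 2Lπ∕d`, mass `≤ π⁴KdL∕2`, `|g(u) − g(a) − g₁(a)(u − a)| ≤ κ(u − a)²`, `|g₁| ≤ 2K`, and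
`|h(s) − h(0) − λs − g(s)| ≤ κ·d²·π⁴∕(8L²)` on `[0, d]` — SECOND ORDER in `1∕L` (module 167: `Kd(1∕π + 3π⁴∕32)∕L`).  The sequel (lineage 188) runs
module 176's budget: `C²` links of `Σ|x_i|` are LOG-FREE.

HONEST FRAMING (binding).  Elementary and [folklore]; NO consumer in the DAG today (degree model of the seat's own currency map); nothing of Bałaban's
instantiated; NE7 NOT PRINTED, NOT proved; N19 NOT discharged; count-neutral.  One finite `T⁴` programme at fixed `ε`; nothing continuum ∕ `ℝ⁴` ∕ OS ∕
mass-gap ∕ Clay.  0 `def` ∕ 0 `sorry`.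
-/

noncomputable section

open Finset MeasureTheory intervalIntegral
open scoped Real

namespace Summit.QuantumFields.YangMills.Theorems.BalabanUVNodesN19C11LinkJacksonSmoothing

open Summit.QuantumFields.YangMills.Theorems.BalabanUVNodesN19JacksonSmoothingC11 (exists_trigLink_near_periodicC11_jackson)
open Summit.QuantumFields.YangMills.Theorems.BalabanUVNodesN19JacksonMeanSecondOrder (continuous_of_abs_sub_le)
open Summit.QuantumFields.YangMills.Theorems.BalabanUVNodesN19LipschitzLinkTrigSmoothing
  (circleNorm_mem_Icc abs_circleNorm_sub_le circleNorm_add_two_pi circleNorm_of_mem_Icc continuous_circleNorm)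

/-! ## §1 The circle norm on the second half-period [bookkeeping] -/

/-- `‖θ‖_{ℝ∕2πℤ} = 2π − θ` for `θ ∈ [π, 2π]`. [bookkeeping] -/
theorem circleNorm_of_mem_Icc_pi {θ : ℝ} (h1 : π ≤ θ) (h2 : θ ≤ 2 * π) : ‖((θ : ℝ) : AddCircle (2 * π))‖ = 2 * π - θ := by
  have e : ((θ : ℝ) : AddCircle (2 * π)) = -(((2 * π - θ : ℝ) : AddCircle (2 * π))) := by
    rw [← QuotientAddGroup.mk_neg, show -(2 * π - θ) = (θ - 2 * π : ℝ) by ring]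
    have := circleNorm_add_two_pi (θ - 2 * π)
    rw [AddCircle.coe_sub, AddCircle.coe_period, sub_zero]
  rw [e, norm_neg]
  exact circleNorm_of_mem_Icc (by linarith) (by linarith)

/-! ## §2 ★★ Second-order trigonometric smoothing of a `C²` link on `[0, d]` [folklore] -/

/-- ★★ **SECOND-ORDER TRIGONOMETRIC SMOOTHING OF A `C²` LINK ON `[0, d]` (Jackson kernel, no Steklov step).**  For `d > 0`, `h` with derivatives
`h′`, `h″` everywhere, `|h′| ≤ K` and `|h″| ≤ κ` on `[0, d]`, and `L ≥ 1`, with `λ = (h(d) − h(0))∕d`: a trigonometric link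
`g(s) = 0 + Σ_p(α_p cos(ω_ps) + β_p sin(ω_ps))` over `p ∈ ((range L)²)² × Bool` with `0 ≤ ω_p ≤ 2Lπ∕d`, `Σ_p(|α_p| + |β_p|) ≤ π⁴KdL∕2`, its formal
derivative `g₁`, `|g(u) − g(a) − g₁(a)(u − a)| ≤ κ(u − a)²` and `|g₁| ≤ 2K` on `ℝ`, `|λ| ≤ K`, and `|h(s) − h(0) − λs − g(s)| ≤ κd²π⁴∕(8L²)` on `[0, d]`
(module 151's input for the de-trended link, `B₂ = κ`, `B₁ = 2K`, `W = π⁴KdL∕2`, `Ω = 2Lπ∕d`; the chord `h(0) + λs` is additive). [folklore] -/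
theorem exists_trigLink_near_C11Link_jackson {d : ℝ} (hd : 0 < d) {h h' h'' : ℝ → ℝ} (hh : ∀ s, HasDerivAt h (h' s) s)
    (hh' : ∀ s, HasDerivAt h' (h'' s) s) {K κ : ℝ} (hK : ∀ s ∈ Set.Icc (0 : ℝ) d, |h' s| ≤ K) (hκ : ∀ s ∈ Set.Icc (0 : ℝ) d, |h'' s| ≤ κ)
    {L : ℕ} (hL : 1 ≤ L) :
    ∃ (α β ω : ((ℕ × ℕ) × (ℕ × ℕ)) × Bool → ℝ) (g g₁ : ℝ → ℝ), (∀ p, 0 ≤ ω p) ∧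
      (∀ p ∈ ((range L ×ˢ range L) ×ˢ (range L ×ˢ range L)) ×ˢ (Finset.univ : Finset Bool), ω p ≤ 2 * L * π / d) ∧
      (∑ p ∈ ((range L ×ˢ range L) ×ˢ (range L ×ˢ range L)) ×ˢ (Finset.univ : Finset Bool), (|α p| + |β p|) ≤ π ^ 4 * (K * d) * L / 2) ∧
      (∀ s, g s = 0 + ∑ p ∈ ((range L ×ˢ range L) ×ˢ (range L ×ˢ range L)) ×ˢ (Finset.univ : Finset Bool),
        (α p * Real.cos (ω p * s) + β p * Real.sin (ω p * s))) ∧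
      (∀ s, g₁ s = ∑ p ∈ ((range L ×ˢ range L) ×ˢ (range L ×ˢ range L)) ×ˢ (Finset.univ : Finset Bool),
        ω p * (β p * Real.cos (ω p * s) - α p * Real.sin (ω p * s))) ∧
      (∀ u a, |g u - g a - g₁ a * (u - a)| ≤ κ * (u - a) ^ 2) ∧ (∀ a, |g₁ a| ≤ 2 * K) ∧ |(h d - h 0) / d| ≤ K ∧
      ∀ s ∈ Set.Icc (0 : ℝ) d, |h s - h 0 - (h d - h 0) / d * s - g s| ≤ κ * d ^ 2 * π ^ 4 / (8 * L ^ 2) := by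
  have hπ := Real.pi_pos
  have hLr : (0 : ℝ) < L := by exact_mod_cast hL
  set P : Finset (((ℕ × ℕ) × (ℕ × ℕ)) × Bool) := ((range L ×ˢ range L) ×ˢ (range L ×ˢ range L)) ×ˢ (Finset.univ : Finset Bool) with hP
  set lam : ℝ := (h d - h 0) / d with hlam
  set c : ℝ := d / π with hc
  have hc0 : 0 < c := by positivity
  have h0mem : (0 : ℝ) ∈ Set.Icc (0 : ℝ) d := ⟨le_rfl, hd.le⟩
  have hK0 : 0 ≤ K := (abs_nonneg _).trans (hK 0 h0mem)
  have hκ0 : 0 ≤ κ := (abs_nonneg _).trans (hκ 0 h0mem)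
  have hh'c : Continuous h' := continuous_iff_continuousAt.2 fun s => (hh' s).continuousAt
  -- the chord slope `|λ| ≤ K` (mean value)
  have hchord : |h d - h 0| ≤ K * d := by
    have key := Convex.norm_image_sub_le_of_norm_hasDerivWithin_le (f := h) (f' := h') (s := Set.Icc (0 : ℝ) d)
      (fun x _ => (hh x).hasDerivWithinAt) (fun x hx => by rw [Real.norm_eq_abs]; exact hK x hx) (convex_Icc 0 d) h0mem ⟨hd.le, le_rfl⟩
    rwa [Real.norm_eq_abs, Real.norm_eq_abs, sub_zero, abs_of_pos hd] at key
  have hlamK : |lam| ≤ K := by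
    rw [hlam, abs_div, abs_of_pos hd, div_le_iff₀ hd]; exact hchord
  -- `h′` is `κ`-Lipschitz on `[0, d]`
  have hLipd : ∀ x y, x ∈ Set.Icc (0 : ℝ) d → y ∈ Set.Icc (0 : ℝ) d → |h' x - h' y| ≤ κ * |x - y| := by
    intro x y hx hy
    have key := Convex.norm_image_sub_le_of_norm_hasDerivWithin_le (f := h') (f' := h'') (s := Set.Icc (0 : ℝ) d)
      (fun z _ => (hh' z).hasDerivWithinAt) (fun z hz => by rw [Real.norm_eq_abs]; exact hκ z hz) (convex_Icc 0 d) hy hx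
    rwa [Real.norm_eq_abs, Real.norm_eq_abs] at key
  -- the even extension of `h′ − λ` in the angle `θ = πs/d`
  set nrm : ℝ → ℝ := fun θ => ‖((θ : ℝ) : AddCircle (2 * π))‖ with hnrm
  have harg : ∀ θ, c * nrm θ ∈ Set.Icc (0 : ℝ) d := by
    intro θ
    obtain ⟨h0, h1⟩ := circleNorm_mem_Icc θ
    refine ⟨by positivity, ?_⟩
    calc c * nrm θ ≤ c * π := mul_le_mul_of_nonneg_left h1 hc0.le
      _ = d := by rw [hc]; field_simp
  set f₁ : ℝ → ℝ := fun θ => c * (h' (c * nrm θ) - lam) with hf₁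
  have hf₁Lip : ∀ a b, |f₁ a - f₁ b| ≤ c ^ 2 * κ * |a - b| := by
    intro a b
    show |c * (h' (c * nrm a) - lam) - c * (h' (c * nrm b) - lam)| ≤ c ^ 2 * κ * |a - b|
    rw [show c * (h' (c * nrm a) - lam) - c * (h' (c * nrm b) - lam) = c * (h' (c * nrm a) - h' (c * nrm b)) by ring, abs_mul, abs_of_pos hc0]
    calc c * |h' (c * nrm a) - h' (c * nrm b)| ≤ c * (κ * |c * nrm a - c * nrm b|) :=
          mul_le_mul_of_nonneg_left (hLipd _ _ (harg a) (harg b)) hc0.le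
      _ = c ^ 2 * κ * |nrm a - nrm b| := by rw [← mul_sub, abs_mul, abs_of_pos hc0]; ring
      _ ≤ c ^ 2 * κ * |a - b| := mul_le_mul_of_nonneg_left (abs_circleNorm_sub_le a b) (by positivity)
  have hf₁bd : ∀ θ, |f₁ θ| ≤ 2 * c * K := by
    intro θ
    show |c * (h' (c * nrm θ) - lam)| ≤ 2 * c * K
    rw [abs_mul, abs_of_pos hc0]
    have := abs_sub (h' (c * nrm θ)) lam
    nlinarith [hK _ (harg θ), hlamK, this, hc0]
  have hf₁per : Function.Periodic f₁ (2 * π) := by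
    intro θ
    show c * (h' (c * nrm (θ + 2 * π)) - lam) = c * (h' (c * nrm θ) - lam)
    rw [hnrm]
    show c * (h' (c * ‖((θ + 2 * π : ℝ) : AddCircle (2 * π))‖) - lam) = c * (h' (c * ‖((θ : ℝ) : AddCircle (2 * π))‖) - lam)
    rw [circleNorm_add_two_pi]
  have hf₁c : Continuous f₁ := continuous_of_abs_sub_le hf₁Lip
  -- on `[0, π]` the extension is `ψ(u) = c(h′(cu) − λ)`, a derivative
  have hψder : ∀ u, HasDerivAt (fun u => h (c * u) - c * lam * u) (c * (h' (c * u) - lam)) u := by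
    intro u
    have h1 : HasDerivAt (fun u => c * u) c u := by simpa using (hasDerivAt_id u).const_mul c
    have h2 : HasDerivAt (fun u => h (c * u)) (h' (c * u) * c) u := (hh (c * u)).comp u h1
    have h3 : HasDerivAt (fun u => c * lam * u) (c * lam) u := by simpa using (hasDerivAt_id u).const_mul (c * lam)
    exact (h2.sub h3).congr_deriv (by ring)
  have hFTC : ∀ θ, ∫ w in (0 : ℝ)..θ, c * (h' (c * w) - lam) = h (c * θ) - h 0 - c * lam * θ := by
    intro θ
    rw [intervalIntegral.integral_eq_sub_of_hasDerivAt (fun u _ => hψder u)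
      ((hh'c.comp (continuous_const.mul continuous_id) |>.sub continuous_const).const_mul c |>.intervalIntegrable _ _)]
    simp only [mul_zero, sub_zero]
    ring
  have hcπ : c * π = d := by rw [hc]; field_simp
  have hkey : h (c * π) - h 0 - c * lam * π = 0 := by
    rw [show c * lam * π = lam * (c * π) by ring, hcπ, hlam]; field_simp; ring
  have hI0π : ∀ θ ∈ Set.Icc (0 : ℝ) π, ∫ w in (0 : ℝ)..θ, f₁ w = h (c * θ) - h 0 - c * lam * θ := by
    intro θ hθ
    have e1 : ∫ w in (0 : ℝ)..θ, f₁ w = ∫ w in (0 : ℝ)..θ, c * (h' (c * w) - lam) := by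
      refine intervalIntegral.integral_congr fun w hw => ?_
      rw [Set.uIcc_of_le hθ.1] at hw
      show c * (h' (c * nrm w) - lam) = c * (h' (c * w) - lam)
      rw [hnrm]
      show c * (h' (c * ‖((w : ℝ) : AddCircle (2 * π))‖) - lam) = c * (h' (c * w) - lam)
      rw [circleNorm_of_mem_Icc hw.1 (hw.2.trans hθ.2)]
    rw [e1, hFTC]
  have hIπ2π : ∫ w in π..(2 * π), f₁ w = 0 := by
    have e1 : ∫ w in π..(2 * π), f₁ w = ∫ w in π..(2 * π), c * (h' (c * (2 * π - w)) - lam) := by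
      refine intervalIntegral.integral_congr fun w hw => ?_
      rw [Set.uIcc_of_le (by linarith)] at hw
      show c * (h' (c * nrm w) - lam) = c * (h' (c * (2 * π - w)) - lam)
      rw [hnrm]
      show c * (h' (c * ‖((w : ℝ) : AddCircle (2 * π))‖) - lam) = c * (h' (c * (2 * π - w)) - lam)
      rw [circleNorm_of_mem_Icc_pi hw.1 hw.2]
    rw [e1, intervalIntegral.integral_comp_sub_left (fun u => c * (h' (c * u) - lam)) (2 * π),
      show 2 * π - 2 * π = (0 : ℝ) by ring, show 2 * π - π = π by ring, hFTC π, hkey]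
  have hI02π : ∫ w in (0 : ℝ)..(0 + 2 * π), f₁ w = 0 := by
    rw [zero_add, ← intervalIntegral.integral_add_adjacent_intervals (hf₁c.intervalIntegrable 0 π) (hf₁c.intervalIntegrable π (2 * π)),
      hIπ2π, hI0π π ⟨hπ.le, le_rfl⟩, hkey, add_zero]
  -- the primitive: `C¹`, periodic, bounded
  set f : ℝ → ℝ := fun θ => ∫ w in (0 : ℝ)..θ, f₁ w with hf
  have hder : ∀ θ, HasDerivAt f (f₁ θ) θ := fun θ => (hf₁c.integral_hasStrictDerivAt 0 θ).hasDerivAt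
  have hfper : Function.Periodic f (2 * π) := by
    intro θ
    show ∫ w in (0 : ℝ)..(θ + 2 * π), f₁ w = ∫ w in (0 : ℝ)..θ, f₁ w
    rw [← intervalIntegral.integral_add_adjacent_intervals (hf₁c.intervalIntegrable 0 θ) (hf₁c.intervalIntegrable θ (θ + 2 * π)),
      hf₁per.intervalIntegral_add_eq θ 0, hI02π, add_zero]
  have hfM : ∀ θ, |f θ| ≤ 4 * K * d := by
    intro θ
    obtain ⟨θ₀, hθ₀, hθe⟩ := hfper.exists_mem_Ico₀ Real.two_pi_pos θ
    rw [hθe]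
    show |∫ w in (0 : ℝ)..θ₀, f₁ w| ≤ 4 * K * d
    have key := intervalIntegral.norm_integral_le_of_norm_le_const (a := (0 : ℝ)) (b := θ₀) (f := f₁) (C := 2 * c * K)
      fun w _ => by rw [Real.norm_eq_abs]; exact hf₁bd w
    rw [Real.norm_eq_abs, sub_zero, abs_of_nonneg hθ₀.1] at key
    refine key.trans ?_
    calc 2 * c * K * θ₀ ≤ 2 * c * K * (2 * π) := mul_le_mul_of_nonneg_left hθ₀.2.le (by positivity)
      _ = 4 * K * d := by rw [hc]; field_simp; ring
  -- the second-order Jackson package on the circle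
  obtain ⟨α, β, ω, hω0, hωL, hmass, hC11, hB1, herr⟩ := exists_trigLink_near_periodicC11_jackson hfper hder hf₁Lip hf₁bd hfM hL
  -- rescale `θ = πs/d`
  refine ⟨α, β, fun p => ω p * (π / d),
    fun s => 0 + ∑ p ∈ P, (α p * Real.cos (ω p * (π / d) * s) + β p * Real.sin (ω p * (π / d) * s)),
    fun s => ∑ p ∈ P, ω p * (π / d) * (β p * Real.cos (ω p * (π / d) * s) - α p * Real.sin (ω p * (π / d) * s)),
    fun p => mul_nonneg (hω0 p) (by positivity), ?_, ?_, fun s => rfl, fun s => rfl, ?_, ?_, hlamK, ?_⟩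
  · -- frequencies
    intro p hp
    calc ω p * (π / d) ≤ (2 * L) * (π / d) := mul_le_mul_of_nonneg_right (hωL p hp) (by positivity)
      _ = 2 * L * π / d := by ring
  · -- mass
    refine hmass.trans (le_of_eq ?_); ring
  · -- `C^{1,1}` by rescaling
    intro u a
    beta_reduce
    have key := hC11 (π * u / d) (π * a / d)
    have e1 : ∀ s, (∑ p ∈ P, (α p * Real.cos (ω p * (π / d) * s) + β p * Real.sin (ω p * (π / d) * s))) =
        ∑ p ∈ P, (α p * Real.cos (ω p * (π * s / d)) + β p * Real.sin (ω p * (π * s / d))) := by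
      intro s; refine Finset.sum_congr rfl fun p _ => ?_; ring_nf
    have e2 : (∑ p ∈ P, ω p * (π / d) * (β p * Real.cos (ω p * (π / d) * a) - α p * Real.sin (ω p * (π / d) * a))) * (u - a) =
        (∑ p ∈ P, ω p * (β p * Real.cos (ω p * (π * a / d)) - α p * Real.sin (ω p * (π * a / d)))) * (π * u / d - π * a / d) := by
      rw [Finset.sum_mul, Finset.sum_mul]
      refine Finset.sum_congr rfl fun p _ => ?_
      have ec : Real.cos (ω p * (π / d) * a) = Real.cos (ω p * (π * a / d)) := by ring_nf
      have es : Real.sin (ω p * (π / d) * a) = Real.sin (ω p * (π * a / d)) := by ring_nf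
      rw [ec, es]
      field_simp
    have e3 : 0 + (∑ p ∈ P, (α p * Real.cos (ω p * (π / d) * u) + β p * Real.sin (ω p * (π / d) * u))) -
        (0 + ∑ p ∈ P, (α p * Real.cos (ω p * (π / d) * a) + β p * Real.sin (ω p * (π / d) * a))) -
        (∑ p ∈ P, ω p * (π / d) * (β p * Real.cos (ω p * (π / d) * a) - α p * Real.sin (ω p * (π / d) * a))) * (u - a) =
        (∑ p ∈ P, (α p * Real.cos (ω p * (π * u / d)) + β p * Real.sin (ω p * (π * u / d)))) -
        (∑ p ∈ P, (α p * Real.cos (ω p * (π * a / d)) + β p * Real.sin (ω p * (π * a / d)))) -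
        (∑ p ∈ P, ω p * (β p * Real.cos (ω p * (π * a / d)) - α p * Real.sin (ω p * (π * a / d)))) * (π * u / d - π * a / d) := by
      rw [e1 u, e1 a, e2]; ring
    rw [e3]
    refine key.trans (le_of_eq ?_)
    rw [show π * u / d - π * a / d = (π / d) * (u - a) by ring, mul_pow, hc]
    field_simp
  · -- `|g₁| ≤ 2K`
    intro a
    beta_reduce
    have key := hB1 (π * a / d)
    have e : (∑ p ∈ P, ω p * (π / d) * (β p * Real.cos (ω p * (π / d) * a) - α p * Real.sin (ω p * (π / d) * a))) =
        (π / d) * ∑ p ∈ P, ω p * (β p * Real.cos (ω p * (π * a / d)) - α p * Real.sin (ω p * (π * a / d))) := by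
      rw [Finset.mul_sum]
      refine Finset.sum_congr rfl fun p _ => ?_; ring_nf
    rw [e, abs_mul, abs_of_pos (by positivity : (0 : ℝ) < π / d)]
    calc π / d * |∑ p ∈ P, ω p * (β p * Real.cos (ω p * (π * a / d)) - α p * Real.sin (ω p * (π * a / d)))|
        ≤ π / d * (2 * c * K) := mul_le_mul_of_nonneg_left key (by positivity)
      _ = 2 * K := by rw [hc]; field_simp
  · -- the error on `[0, d]`
    intro s hs
    beta_reduce
    have hθ0 : 0 ≤ π * s / d := by have := hs.1; positivity
    have hθπ : π * s / d ≤ π := by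
      rw [div_le_iff₀ hd]; nlinarith [hs.2, hπ]
    have hfs : f (π * s / d) = h s - h 0 - lam * s := by
      show ∫ w in (0 : ℝ)..(π * s / d), f₁ w = h s - h 0 - lam * s
      rw [hI0π _ ⟨hθ0, hθπ⟩, show c * (π * s / d) = s by rw [hc]; field_simp]
      rw [hc]; field_simp
    have key := herr (π * s / d)
    rw [hfs] at key
    have e1 : (∑ p ∈ P, (α p * Real.cos (ω p * (π / d) * s) + β p * Real.sin (ω p * (π / d) * s))) =
        ∑ p ∈ P, (α p * Real.cos (ω p * (π * s / d)) + β p * Real.sin (ω p * (π * s / d))) := by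
      refine Finset.sum_congr rfl fun p _ => ?_; ring_nf
    rw [show h s - h 0 - lam * s - (0 + ∑ p ∈ P, (α p * Real.cos (ω p * (π / d) * s) + β p * Real.sin (ω p * (π / d) * s))) =
      -((∑ p ∈ P, (α p * Real.cos (ω p * (π * s / d)) + β p * Real.sin (ω p * (π * s / d)))) - (h s - h 0 - lam * s)) by rw [e1]; ring,
      abs_neg]
    refine key.trans (le_of_eq ?_)
    have hc2 : c ^ 2 * π ^ 2 = d ^ 2 := by rw [hc]; field_simp
    rw [← hc2]; ring

end Summit.QuantumFields.YangMills.Theorems.BalabanUVNodesN19C11LinkJacksonSmoothing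

end
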